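import Mathlib.Probability.Moments.ComplexMGF
import Mathlib.Analysis.Complex.TaylorSeries
import Mathlib.Analysis.SpecialFunctions.Exponential
import Mathlib.Analysis.Convex.Function
import HarnessLib

/-!
# Three analytic lemmas for the Selberg integral

Generic analysis used in the proof of Selberg's integral formula
(`Literature.Analysis.SpecialFunctions.selberg_integral_formula`) along Aomoto's route
(G. E. Andrews, R. Askey, R. Roy, *Special Functions* (1999), §8.2 and §1.9 (Bohr–Mollerup);
D. V. Widder, *The Laplace Transform* (1941), Ch. II §5 (Landau's theorem on the singularity at
the abscissa of convergence)):

* `mgf_mul_add_mul_le_rpow` — Laplace transforms `s ↦ ∫ e^{sX} dμ` of measures are log-convex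
  (Hölder's inequality);
* `BohrMollerup.eq_of_logConvex` — a Bohr–Mollerup-type uniqueness theorem: two positive
  log-convex functions on `[1, ∞)` satisfying the same first-order recurrence
  `f(x+1) = r(x) f(x)` with `r(x) → 1` are proportional;
* `Landau.integrable_and_mgf_eq` — Landau-type analytic continuation: if `X ≤ 0`, the Laplace
  transform `s ↦ ∫ e^{sX} dμ` converges for `s > s₁` and agrees there with a function holomorphic
  on the half-plane `Re z > a` (`a ≤ s₁`), then it converges and agrees with it for all `s > a`.

Everything here is fully proved; no named facts.
-/

noncomputable section

open MeasureTheory ProbabilityTheory Real Filter Topology Set Finset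

open scoped Nat

namespace Literature.Analysis.SpecialFunctions

namespace Selberg

/-! ### Log-convexity of Laplace transforms (Hölder) -/

/-- **Laplace transforms of measures are log-convex** (Hölder's inequality): for `a, b > 0`,
`a + b = 1`, `∫ e^{(as+bt)X} dμ ≤ (∫ e^{sX} dμ)^a (∫ e^{tX} dμ)^b` whenever both exponentials are
integrable. [folklore] -/
theorem mgf_mul_add_mul_le_rpow {Ω : Type*} [MeasurableSpace Ω] {μ : Measure Ω} {X : Ω → ℝ}
    (hX : AEMeasurable X μ) {s t a b : ℝ}
    (hs : Integrable (fun ω => exp (s * X ω)) μ) (ht : Integrable (fun ω => exp (t * X ω)) μ)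
    (ha : 0 < a) (hb : 0 < b) (hab : a + b = 1) :
    mgf X μ (a * s + b * t) ≤ mgf X μ s ^ a * mgf X μ t ^ b := by
  let f : ℝ → ℝ → Ω → ℝ := fun c u ω => exp (c * u * X ω)
  have e : HolderConjugate (1 / a) (1 / b) := Real.holderConjugate_one_div ha hb hab
  have posf : ∀ c u ω, 0 ≤ f c u ω := fun _ _ _ => (exp_pos _).le
  have fpow : ∀ {c : ℝ} (_ : 0 < c) (u : ℝ) (ω : Ω), exp (u * X ω) = f c u ω ^ (1 / c) := by
    intro c hc u ω
    simp only [f]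
    rw [← exp_mul]
    congr 1
    field_simp
  have fmeas : ∀ c u : ℝ, AEStronglyMeasurable (f c u) μ := fun c u =>
    (measurable_exp.comp_aemeasurable (hX.const_mul (c * u))).aestronglyMeasurable
  have f_mem_Lp : ∀ {c u : ℝ} (_ : 0 < c) (_ : Integrable (fun ω => exp (u * X ω)) μ),
      MemLp (f c u) (ENNReal.ofReal (1 / c)) μ := by
    intro c u hc hu
    have A : ENNReal.ofReal (1 / c) ≠ 0 := by
      rwa [Ne, ENNReal.ofReal_eq_zero, not_le, one_div_pos]
    have B : ENNReal.ofReal (1 / c) ≠ ⊤ := ENNReal.ofReal_ne_top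
    rw [← memLp_norm_rpow_iff (fmeas c u) A B, ENNReal.toReal_ofReal (one_div_nonneg.mpr hc.le),
      ENNReal.div_self A B, memLp_one_iff_integrable]
    apply hu.congr
    refine Eventually.of_forall fun ω => ?_
    show exp (u * X ω) = ‖f c u ω‖ ^ (1 / c)
    rw [fpow hc u ω, norm_of_nonneg (posf _ _ ω)]
  simp only [mgf]
  convert MeasureTheory.integral_mul_le_Lp_mul_Lq_of_nonneg e (ae_of_all _ (posf a s))
    (ae_of_all _ (posf b t)) (f_mem_Lp ha hs) (f_mem_Lp hb ht) using 1
  · refine integral_congr_ae (ae_of_all _ fun ω => ?_)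
    simp only [f]
    rw [← exp_add]
    congr 1
    ring
  · rw [one_div_one_div, one_div_one_div]
    congr 2 <;> exact integral_congr_ae (ae_of_all _ fun ω => fpow (by assumption) _ ω)

/-- Log-convexity of the Laplace transform, logarithmic form: on any convex set of parameters where
`e^{sX}` is integrable and `μ ≠ 0`, `s ↦ log ∫ e^{sX} dμ` is convex. [folklore] -/
theorem convexOn_log_mgf {Ω : Type*} [MeasurableSpace Ω] {μ : Measure Ω} [NeZero μ] {X : Ω → ℝ}
    (hX : AEMeasurable X μ) {D : Set ℝ} (hD : Convex ℝ D)
    (hint : ∀ s ∈ D, Integrable (fun ω => exp (s * X ω)) μ) :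
    ConvexOn ℝ D (fun s => log (mgf X μ s)) := by
  refine convexOn_iff_forall_pos.mpr ⟨hD, fun x hx y hy a b ha hb hab => ?_⟩
  simp_rw [smul_eq_mul]
  have hxpos : 0 < mgf X μ x := mgf_pos' (NeZero.ne μ) (hint x hx)
  have hypos : 0 < mgf X μ y := mgf_pos' (NeZero.ne μ) (hint y hy)
  rw [← log_rpow hxpos, ← log_rpow hypos, ← log_mul (rpow_pos_of_pos hxpos a).ne'
    (rpow_pos_of_pos hypos b).ne']
  gcongr
  · exact mgf_pos' (NeZero.ne μ) (hint _ (hD hx hy ha.le hb.le hab))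
  · exact mgf_mul_add_mul_le_rpow hX (hint x hx) (hint y hy) ha hb hab

/-! ### A Bohr–Mollerup-type uniqueness theorem -/

namespace BohrMollerup

/-- Three-point inequality for a convex function on `[1,∞)`: `u(q+x) ≤ (1-x)u(q) + x u(q+1)`
for `q ≥ 1`, `x ∈ [0,1]`. [folklore] -/
theorem upper {u : ℝ → ℝ} (hu : ConvexOn ℝ (Set.Ici 1) u) {q x : ℝ} (hq : 1 ≤ q) (hx0 : 0 ≤ x)
    (hx1 : x ≤ 1) : u (q + x) ≤ (1 - x) * u q + x * u (q + 1) := by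
  have h := hu.2 (x := q) (y := q + 1) (Set.mem_Ici.2 hq) (Set.mem_Ici.2 (by linarith))
    (by linarith : 0 ≤ 1 - x) hx0 (by ring)
  simp only [smul_eq_mul] at h
  have e : (1 - x) * q + x * (q + 1) = q + x := by ring
  rw [e] at h
  exact h

/-- Three-point inequality for a convex function on `[1,∞)`: `u(q+1) ≤ x u(q+x) + (1-x) u(q+1+x)`
for `q ≥ 1`, `x ∈ [0,1]`. [folklore] -/
theorem lower {u : ℝ → ℝ} (hu : ConvexOn ℝ (Set.Ici 1) u) {q x : ℝ} (hq : 1 ≤ q) (hx0 : 0 ≤ x)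
    (hx1 : x ≤ 1) : u (q + 1) ≤ x * u (q + x) + (1 - x) * u (q + x + 1) := by
  have h := hu.2 (x := q + x) (y := q + x + 1) (Set.mem_Ici.2 (by linarith))
    (Set.mem_Ici.2 (by linarith)) hx0 (by linarith : 0 ≤ 1 - x) (by ring)
  simp only [smul_eq_mul] at h
  have e : x * (q + x) + (1 - x) * (q + x + 1) = q + 1 := by ring
  rw [e] at h
  exact h

/-- Iterating the recurrence in logarithmic form:
`log f(y+k) = log f(y) + ∑_{i<k} log r(y+i)` for `y ≥ 1`. [folklore] -/
theorem log_iterate {f r : ℝ → ℝ} (hf : ∀ x, 1 ≤ x → 0 < f x) (hr : ∀ x, 1 ≤ x → 0 < r x)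
    (hrec : ∀ x, 1 ≤ x → f (x + 1) = r x * f x) {y : ℝ} (hy : 1 ≤ y) (k : ℕ) :
    log (f (y + k)) = log (f y) + ∑ i ∈ range k, log (r (y + i)) := by
  induction k with
  | zero => simp
  | succ k ih =>
    have hyk : 1 ≤ y + k := by
      have : (0 : ℝ) ≤ k := by positivity
      linarith
    rw [Finset.sum_range_succ, Nat.cast_succ, ← add_assoc, hrec _ hyk,
      log_mul (hr _ hyk).ne' (hf _ hyk).ne', ih]
    ring

/-- Iterating the recurrence: `f(y+k) = f(y) ∏_{i<k} r(y+i)` for `y ≥ 1`. [folklore] -/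
theorem iterate {f r : ℝ → ℝ} (hrec : ∀ x, 1 ≤ x → f (x + 1) = r x * f x) {y : ℝ} (hy : 1 ≤ y)
    (k : ℕ) : f (y + k) = f y * ∏ i ∈ range k, r (y + i) := by
  induction k with
  | zero => simp
  | succ k ih =>
    have hyk : 1 ≤ y + k := by
      have : (0 : ℝ) ≤ k := by positivity
      linarith
    rw [Finset.prod_range_succ, Nat.cast_succ, ← add_assoc, hrec _ hyk, ih]
    ring

/-- The key estimate: for two positive log-convex solutions of the same recurrence, the quantity
`(log f(1+x) - log f(1)) - (log g(1+x) - log g(1))` is bounded by `|log r(q+x)| + |log r(q)|` for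
every integer `q ≥ 1`. [folklore] -/
theorem abs_sub_le {f g r : ℝ → ℝ} (hf : ∀ x, 1 ≤ x → 0 < f x) (hg : ∀ x, 1 ≤ x → 0 < g x)
    (hr : ∀ x, 1 ≤ x → 0 < r x) (hfc : ConvexOn ℝ (Set.Ici 1) fun x => log (f x))
    (hgc : ConvexOn ℝ (Set.Ici 1) fun x => log (g x))
    (hfr : ∀ x, 1 ≤ x → f (x + 1) = r x * f x) (hgr : ∀ x, 1 ≤ x → g (x + 1) = r x * g x)
    {x : ℝ} (hx0 : 0 ≤ x) (hx1 : x ≤ 1) {q : ℕ} (hq : 1 ≤ q) :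
    |(log (f (1 + x)) - log (f 1)) - (log (g (1 + x)) - log (g 1))| ≤
      |log (r (q + x))| + |log (r q)| := by
  have hq' : (1 : ℝ) ≤ q := by exact_mod_cast hq
  -- recurrence in log form
  have lf : ∀ y, 1 ≤ y → log (f (y + 1)) = log (r y) + log (f y) := fun y hy => by
    rw [hfr y hy, log_mul (hr y hy).ne' (hf y hy).ne']
  have lg : ∀ y, 1 ≤ y → log (g (y + 1)) = log (r y) + log (g y) := fun y hy => by
    rw [hgr y hy, log_mul (hr y hy).ne' (hg y hy).ne']
  set A := log (r q) with hA
  set B := log (r (q + x)) with hB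
  -- two-sided bounds for `f`
  have Uf : log (f (q + x)) - log (f q) ≤ x * A := by
    have h := upper hfc hq' hx0 hx1
    have e := lf q hq'
    nlinarith [h, e]
  have Lf : A - (1 - x) * B ≤ log (f (q + x)) - log (f q) := by
    have h := lower hfc hq' hx0 hx1
    have e1 := lf q hq'
    have e2 := lf (q + x) (by linarith)
    nlinarith [h, e1, e2]
  -- two-sided bounds for `g`
  have Ug : log (g (q + x)) - log (g q) ≤ x * A := by
    have h := upper hgc hq' hx0 hx1
    have e := lg q hq'
    nlinarith [h, e]
  have Lg : A - (1 - x) * B ≤ log (g (q + x)) - log (g q) := by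
    have h := lower hgc hq' hx0 hx1
    have e1 := lg q hq'
    have e2 := lg (q + x) (by linarith)
    nlinarith [h, e1, e2]
  -- the difference of the two increments does not depend on `q`
  have hΔ : (log (f (q + x)) - log (f q)) - (log (g (q + x)) - log (g q)) =
      (log (f (1 + x)) - log (f 1)) - (log (g (1 + x)) - log (g 1)) := by
    have h1 := log_iterate hf hr hfr (y := 1 + x) (by linarith) (q - 1)
    have h2 := log_iterate hf hr hfr (y := 1) le_rfl (q - 1)
    have h3 := log_iterate hg hr hgr (y := 1 + x) (by linarith) (q - 1)
    have h4 := log_iterate hg hr hgr (y := 1) le_rfl (q - 1)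
    have e : ((q - 1 : ℕ) : ℝ) = q - 1 := by
      rw [Nat.cast_sub hq]; simp
    rw [e] at h1 h2 h3 h4
    have e1 : (1 + x + ((q : ℝ) - 1)) = q + x := by ring
    have e2 : (1 + ((q : ℝ) - 1)) = q := by ring
    rw [e1] at h1 h3
    rw [e2] at h2 h4
    linarith
  rw [← hΔ, abs_le]
  have hxB : x * (-|A| - |B|) ≤ 0 :=
    mul_nonpos_of_nonneg_of_nonpos hx0 (by linarith [abs_nonneg A, abs_nonneg B])
  have hAl : -|A| ≤ A := neg_abs_le A
  have hAu : A ≤ |A| := le_abs_self A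
  have hBl : -|B| ≤ B := neg_abs_le B
  have hBu : B ≤ |B| := le_abs_self B
  constructor
  · -- lower bound: the difference is at least `(1-x)(A - B)`
    have h1 : (1 - x) * (-|A| - |B|) ≤ (1 - x) * (A - B) :=
      mul_le_mul_of_nonneg_left (by linarith) (by linarith)
    nlinarith
  · -- upper bound: the difference is at most `(1-x)(B - A)`
    have h1 : (1 - x) * (-|A| - |B|) ≤ (1 - x) * (A - B) * (-1) := by
      have : (1 - x) * (-|A| - |B|) ≤ (1 - x) * (B - A) :=
        mul_le_mul_of_nonneg_left (by linarith) (by linarith)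
      linarith
    nlinarith

/-- For `x ∈ [0,1]`, the normalised logarithmic increments of two positive log-convex solutions of
the same recurrence with multiplier `r → 1` agree. [folklore] -/
theorem log_sub_log_eq {f g r : ℝ → ℝ} (hf : ∀ x, 1 ≤ x → 0 < f x) (hg : ∀ x, 1 ≤ x → 0 < g x)
    (hr : ∀ x, 1 ≤ x → 0 < r x) (hfc : ConvexOn ℝ (Set.Ici 1) fun x => log (f x))
    (hgc : ConvexOn ℝ (Set.Ici 1) fun x => log (g x))
    (hfr : ∀ x, 1 ≤ x → f (x + 1) = r x * f x) (hgr : ∀ x, 1 ≤ x → g (x + 1) = r x * g x)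
    (hlim : Tendsto r atTop (𝓝 1)) {x : ℝ} (hx0 : 0 ≤ x) (hx1 : x ≤ 1) :
    log (f (1 + x)) - log (f 1) = log (g (1 + x)) - log (g 1) := by
  have hlog : Tendsto (fun q : ℕ => |log (r (q + x))| + |log (r q)|) atTop (𝓝 0) := by
    have h1 : Tendsto (fun q : ℕ => r ((q : ℝ) + x)) atTop (𝓝 1) :=
      hlim.comp (tendsto_atTop_add_const_right _ x tendsto_natCast_atTop_atTop)
    have h2 : Tendsto (fun q : ℕ => r (q : ℝ)) atTop (𝓝 1) :=
      hlim.comp tendsto_natCast_atTop_atTop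
    have h1' := ((continuousAt_log one_ne_zero).tendsto.comp h1).abs
    have h2' := ((continuousAt_log one_ne_zero).tendsto.comp h2).abs
    simpa using h1'.add h2'
  have hle : |(log (f (1 + x)) - log (f 1)) - (log (g (1 + x)) - log (g 1))| ≤ 0 := by
    refine ge_of_tendsto hlog ?_
    filter_upwards [eventually_ge_atTop 1] with q hq
    exact abs_sub_le hf hg hr hfc hgc hfr hgr hx0 hx1 hq
  have := abs_nonpos_iff.1 hle
  linarith

/-- **Bohr–Mollerup-type uniqueness.** Two positive log-convex functions on `[1,∞)` satisfying
the same recurrence `f(x+1) = r(x)f(x)`, `g(x+1) = r(x)g(x)` with `r > 0`, `r(x) → 1` as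
`x → ∞`, are proportional: `f(y) g(1) = g(y) f(1)` for all `y ≥ 1`. (For `r(x) = x` and `g = Γ`
this is the Bohr–Mollerup theorem.) [folklore] -/
theorem eq_of_logConvex {f g r : ℝ → ℝ} (hf : ∀ x, 1 ≤ x → 0 < f x) (hg : ∀ x, 1 ≤ x → 0 < g x)
    (hr : ∀ x, 1 ≤ x → 0 < r x) (hfc : ConvexOn ℝ (Set.Ici 1) fun x => log (f x))
    (hgc : ConvexOn ℝ (Set.Ici 1) fun x => log (g x))
    (hfr : ∀ x, 1 ≤ x → f (x + 1) = r x * f x) (hgr : ∀ x, 1 ≤ x → g (x + 1) = r x * g x)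
    (hlim : Tendsto r atTop (𝓝 1)) {y : ℝ} (hy : 1 ≤ y) :
    f y * g 1 = g y * f 1 := by
  -- write `y = 1 + x + k` with `k = ⌊y - 1⌋₊`, `x ∈ [0,1)`
  set k : ℕ := ⌊y - 1⌋₊ with hk
  set x : ℝ := y - 1 - k with hx
  have hx0 : 0 ≤ x := by
    have := Nat.floor_le (show 0 ≤ y - 1 by linarith)
    simp only [hx]; linarith
  have hx1 : x ≤ 1 := by
    have := Nat.lt_floor_add_one (y - 1)
    simp only [hx]; linarith
  have hyx : y = (1 + x) + k := by simp only [hx]; ring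
  have ef := iterate hfr (y := 1 + x) (by linarith) k
  have eg := iterate hgr (y := 1 + x) (by linarith) k
  have hD := log_sub_log_eq hf hg hr hfc hgc hfr hgr hlim hx0 hx1
  have h1x : f (1 + x) * g 1 = g (1 + x) * f 1 := by
    have hf1 := hf 1 le_rfl
    have hg1 := hg 1 le_rfl
    have hfx := hf (1 + x) (by linarith)
    have hgx := hg (1 + x) (by linarith)
    have hlogeq : log (f (1 + x) * g 1) = log (g (1 + x) * f 1) := by
      rw [log_mul hfx.ne' hg1.ne', log_mul hgx.ne' hf1.ne']
      linarith
    exact log_injOn_pos (Set.mem_Ioi.2 (mul_pos hfx hg1)) (Set.mem_Ioi.2 (mul_pos hgx hf1))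
      hlogeq
  rw [hyx, ef, eg]
  calc f (1 + x) * (∏ i ∈ range k, r (1 + x + i)) * g 1
      = (f (1 + x) * g 1) * ∏ i ∈ range k, r (1 + x + i) := by ring
    _ = (g (1 + x) * f 1) * ∏ i ∈ range k, r (1 + x + i) := by rw [h1x]
    _ = g (1 + x) * (∏ i ∈ range k, r (1 + x + i)) * f 1 := by ring

end BohrMollerup

/-! ### Landau-type analytic continuation of Laplace transforms -/

namespace Landau

/-- The power series of the exponential, real version. [folklore] -/
theorem hasSum_pow_div_factorial_mul_exp (u v : ℝ) :
    HasSum (fun n : ℕ => u ^ n / n ! * exp v) (exp (u + v)) := by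
  have h : HasSum (fun n : ℕ => u ^ n / n !) (exp u) := by
    rw [Real.exp_eq_exp_ℝ]
    exact NormedSpace.expSeries_div_hasSum_exp u
  rw [exp_add]
  exact h.mul_right (exp v)

/-- **Landau-type analytic continuation of a Laplace transform.** Let `X ≤ 0` a.e. and suppose
`e^{sX}` is `μ`-integrable for all `s > s₁`, with `∫ e^{sX} dμ = G(s)` there, where `G` is
holomorphic on the half-plane `{Re z > a}`, `a ≤ s₁`. Then `e^{sX}` is integrable and
`∫ e^{sX} dμ = G(s)` for every real `s > a`. (The abscissa of convergence of the Laplace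
transform of a positive measure is a singularity: Landau 1906; Widder, *The Laplace Transform*,
Ch. II, Thm. 5b.) [folklore] -/
theorem integrable_and_mgf_eq {Ω : Type*} [MeasurableSpace Ω] {μ : Measure Ω} {X : Ω → ℝ}
    (hX0 : ∀ᵐ ω ∂μ, X ω ≤ 0) {a s₁ : ℝ} (has : a ≤ s₁) {G : ℂ → ℂ}
    (hG : DifferentiableOn ℂ G {z : ℂ | a < z.re})
    (hint : ∀ s : ℝ, s₁ < s → Integrable (fun ω => exp (s * X ω)) μ)
    (heq : ∀ s : ℝ, s₁ < s → (mgf X μ s : ℂ) = G s) :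
    ∀ s : ℝ, a < s → Integrable (fun ω => exp (s * X ω)) μ ∧ (mgf X μ s : ℂ) = G s := by
  -- the set `T` of admissible abscissae and its infimum `s₀`
  set T : Set ℝ := {s | a ≤ s ∧ ∀ s' : ℝ, s < s' → Integrable (fun ω => exp (s' * X ω)) μ}
    with hT
  have hs₁T : s₁ ∈ T := ⟨has, hint⟩
  have hTne : T.Nonempty := ⟨s₁, hs₁T⟩
  have hTbdd : BddBelow T := ⟨a, fun s hs => hs.1⟩
  set s₀ := sInf T with hs₀
  have has₀ : a ≤ s₀ := le_csInf hTne fun s hs => hs.1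
  -- (1) integrability beyond `s₀`
  have hint₀ : ∀ s' : ℝ, s₀ < s' → Integrable (fun ω => exp (s' * X ω)) μ := by
    intro s' hs'
    obtain ⟨t, htT, hts'⟩ := exists_lt_of_csInf_lt hTne hs'
    exact htT.2 s' hts'
  have hsub : Set.Ioi s₀ ⊆ interior (integrableExpSet X μ) :=
    interior_maximal (fun s hs => hint₀ s hs) isOpen_Ioi
  -- (2) equality beyond `s₀`: identity theorem on the half-plane `U = {s₀ < Re z}`
  set U : Set ℂ := {z | s₀ < z.re} with hU
  have hUo : IsOpen U := isOpen_lt continuous_const Complex.continuous_re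
  have hUconn : IsPreconnected U := (convex_halfSpace_re_gt s₀).isPreconnected
  have hF : AnalyticOnNhd ℂ (complexMGF X μ) U := fun z hz =>
    analyticAt_complexMGF (hsub (by simpa [hU] using hz))
  have hGU : AnalyticOnNhd ℂ G U :=
    (hG.mono fun z hz => lt_of_le_of_lt has₀ (by simpa [hU] using hz)).analyticOnNhd hUo
  have hz₀ : ((s₁ + 1 : ℝ) : ℂ) ∈ U := by
    have : s₀ ≤ s₁ := csInf_le hTbdd hs₁T
    simp only [hU, Set.mem_setOf_eq, Complex.ofReal_re]
    linarith
  have hfreq : ∃ᶠ z in 𝓝[≠] ((s₁ + 1 : ℝ) : ℂ), complexMGF X μ z = G z := by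
    have h_real : ∃ᶠ x : ℝ in 𝓝[≠] (s₁ + 1), complexMGF X μ x = G x := by
      have hev : ∀ᶠ x : ℝ in 𝓝[≠] (s₁ + 1), complexMGF X μ x = G x := by
        have : ∀ᶠ x : ℝ in 𝓝 (s₁ + 1), s₁ < x := Ioi_mem_nhds (by linarith)
        filter_upwards [nhdsWithin_le_nhds this] with x hx
        rw [complexMGF_ofReal, heq x hx]
      exact hev.frequently
    rw [frequently_iff_seq_forall] at h_real ⊢
    obtain ⟨xs, hx_tendsto, hx_eq⟩ := h_real
    refine ⟨fun n => (xs n : ℂ), ?_, fun n => hx_eq n⟩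
    rw [tendsto_nhdsWithin_iff] at hx_tendsto ⊢
    constructor
    · exact (Complex.continuous_ofReal.tendsto _).comp hx_tendsto.1
    · filter_upwards [hx_tendsto.2] with n hn
      simp only [Set.mem_compl_iff, Set.mem_singleton_iff] at hn ⊢
      exact fun h => hn (by exact_mod_cast h)
  have hEqU : Set.EqOn (complexMGF X μ) G U :=
    hF.eqOn_of_preconnected_of_frequently_eq hGU hUconn hz₀ hfreq
  have heq₀ : ∀ s' : ℝ, s₀ < s' → (mgf X μ s' : ℂ) = G s' := by
    intro s' hs'
    have h := hEqU (show ((s' : ℝ) : ℂ) ∈ U by simpa [hU] using hs')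
    rwa [complexMGF_ofReal] at h
  -- (3) `s₀ = a`, by Landau's positivity argument
  by_cases hlt : a < s₀
  · exfalso
    set δ : ℝ := (s₀ - a) / 3 with hδ
    have hδpos : 0 < δ := by simp only [hδ]; linarith
    set s₂ : ℝ := s₀ + δ with hs₂
    have hs₀₂ : s₀ < s₂ := by simp only [hs₂]; linarith
    have hs₂int : s₂ ∈ interior (integrableExpSet X μ) := hsub hs₀₂
    have hXm : AEMeasurable X μ := aemeasurable_of_mem_interior_integrableExpSet hs₂int
    -- the disc of radius `2δ` about `s₂` lies in the half-plane of holomorphy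
    have hball : Metric.ball ((s₂ : ℝ) : ℂ) (2 * δ) ⊆ {z : ℂ | a < z.re} := by
      intro z hz
      rw [Metric.mem_ball, dist_eq_norm] at hz
      have h1 : |(z - (s₂ : ℂ)).re| ≤ ‖z - (s₂ : ℂ)‖ := Complex.abs_re_le_norm _
      simp only [Complex.sub_re, Complex.ofReal_re] at h1
      simp only [Set.mem_setOf_eq]
      have := (abs_le.1 (h1.trans hz.le)).1
      simp only [hs₂, hδ] at this ⊢
      linarith
    have hGball : DifferentiableOn ℂ G (Metric.ball ((s₂ : ℝ) : ℂ) (2 * δ)) := hG.mono hball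
    -- Taylor coefficients of `G` at `s₂` are the moments `∫ Xⁿ e^{s₂X} dμ`
    have hs₂U : ((s₂ : ℝ) : ℂ) ∈ U := by simpa [hU] using hs₀₂
    have hder : ∀ n : ℕ, iteratedDeriv n G ((s₂ : ℝ) : ℂ) =
        ((∫ ω, X ω ^ n * exp (s₂ * X ω) ∂μ : ℝ) : ℂ) := by
      intro n
      have hEq' : G =ᶠ[𝓝 ((s₂ : ℝ) : ℂ)] complexMGF X μ :=
        (hEqU.symm.eventuallyEq_of_mem (hUo.mem_nhds hs₂U))
      rw [hEq'.iteratedDeriv_eq, iteratedDeriv_complexMGF (by simpa using hs₂int) n,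
        ← integral_complex_ofReal]
      refine integral_congr_ae (ae_of_all _ fun ω => ?_)
      simp only [Complex.ofReal_mul, Complex.ofReal_pow, Complex.ofReal_exp]
    -- integrability on `(s₀ - δ, s₂]`
    have hnew : ∀ s : ℝ, s₀ - δ < s → s ≤ s₂ → Integrable (fun ω => exp (s * X ω)) μ := by
      intro s hs1 hs2
      have hsball : ((s : ℝ) : ℂ) ∈ Metric.ball ((s₂ : ℝ) : ℂ) (2 * δ) := by
        rw [Metric.mem_ball, dist_eq_norm, ← Complex.ofReal_sub, Complex.norm_real, Real.norm_eq_abs,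
          abs_lt]
        simp only [hs₂] at hs2 ⊢
        constructor <;> linarith
      have hTaylor := Complex.hasSum_taylorSeries_on_ball hGball hsball
      -- the terms of the Taylor series, as real numbers
      set c : ℕ → ℝ := fun n => (s - s₂) ^ n / n ! * ∫ ω, X ω ^ n * exp (s₂ * X ω) ∂μ with hc
      have hterm : ∀ n : ℕ, ((n ! : ℂ)⁻¹ • ((s : ℂ) - (s₂ : ℝ)) ^ n • iteratedDeriv n G ((s₂ : ℝ) : ℂ))
          = ((c n : ℝ) : ℂ) := by
        intro n
        rw [hder n]
        simp only [hc, smul_eq_mul]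
        push_cast
        ring
      have hsumC : HasSum (fun n : ℕ => ((c n : ℝ) : ℂ)) (G s) := by
        have := hTaylor
        simp_rw [hterm] at this
        exact this
      have hsumR : HasSum c (G s).re := by
        have := Complex.hasSum_re hsumC
        simpa using this
      -- the nonnegative functions `Φ n` with `∫ Φ n = c n` and `∑ Φ n = e^{sX}`
      set Φ : ℕ → Ω → ℝ := fun n ω => (s - s₂) ^ n / n ! * (X ω ^ n * exp (s₂ * X ω)) with hΦ
      have hΦ_alt : ∀ n ω, Φ n ω = ((s - s₂) * X ω) ^ n / n ! * exp (s₂ * X ω) := by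
        intro n ω
        simp only [hΦ]
        rw [mul_pow]
        ring
      have hΦ_pt_nonneg : ∀ ω, X ω ≤ 0 → ∀ n, 0 ≤ Φ n ω := by
        intro ω hω n
        have : 0 ≤ (s - s₂) * X ω := mul_nonneg_of_nonpos_of_nonpos (by linarith) hω
        rw [hΦ_alt]
        positivity
      have hΦ_nonneg : ∀ n, 0 ≤ᵐ[μ] Φ n := by
        intro n
        filter_upwards [hX0] with ω hω
        exact hΦ_pt_nonneg ω hω n
      have hΦ_int : ∀ n, Integrable (Φ n) μ := fun n =>
        (integrable_pow_mul_exp_of_mem_interior_integrableExpSet hs₂int n).const_mul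
          ((s - s₂) ^ n / n !)
      have hΦ_val : ∀ n, ∫ ω, Φ n ω ∂μ = c n := by
        intro n
        simp only [hΦ, hc]
        exact integral_const_mul _ _
      have hpt : ∀ ω, HasSum (fun n => Φ n ω) (exp (s * X ω)) := by
        intro ω
        have h := hasSum_pow_div_factorial_mul_exp ((s - s₂) * X ω) (s₂ * X ω)
        have e : (s - s₂) * X ω + s₂ * X ω = s * X ω := by ring
        rw [e] at h
        have e2 : (fun n => Φ n ω) = fun n => ((s - s₂) * X ω) ^ n / n ! * exp (s₂ * X ω) :=
          funext fun n => hΦ_alt n ω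
        rw [e2]
        exact h
      -- Tonelli
      have hlin : ∫⁻ ω, ENNReal.ofReal (exp (s * X ω)) ∂μ =
          ∑' n, ENNReal.ofReal (∫ ω, Φ n ω ∂μ) := by
        calc ∫⁻ ω, ENNReal.ofReal (exp (s * X ω)) ∂μ
            = ∫⁻ ω, ∑' n, ENNReal.ofReal (Φ n ω) ∂μ := by
              refine lintegral_congr_ae ?_
              filter_upwards [hX0] with ω hω
              rw [← ENNReal.ofReal_tsum_of_nonneg (hΦ_pt_nonneg ω hω) (hpt ω).summable,
                (hpt ω).tsum_eq]
          _ = ∑' n, ∫⁻ ω, ENNReal.ofReal (Φ n ω) ∂μ :=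
              lintegral_tsum fun n => (hΦ_int n).aestronglyMeasurable.aemeasurable.ennreal_ofReal
          _ = ∑' n, ENNReal.ofReal (∫ ω, Φ n ω ∂μ) := by
              refine tsum_congr fun n => ?_
              rw [ofReal_integral_eq_lintegral_ofReal (hΦ_int n) (hΦ_nonneg n)]
      have hc_nonneg : ∀ n, 0 ≤ c n := fun n => by
        rw [← hΦ_val n]; exact integral_nonneg_of_ae (hΦ_nonneg n)
      have hfin : ∫⁻ ω, ENNReal.ofReal (exp (s * X ω)) ∂μ < ⊤ := by
        rw [hlin]
        simp_rw [hΦ_val]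
        rw [← ENNReal.ofReal_tsum_of_nonneg hc_nonneg hsumR.summable]
        exact ENNReal.ofReal_lt_top
      refine ⟨(measurable_exp.comp_aemeasurable (hXm.const_mul s)).aestronglyMeasurable, ?_⟩
      rw [hasFiniteIntegral_iff_ofReal (ae_of_all _ fun ω => (exp_pos _).le)]
      exact hfin
    -- hence `s₀ - δ ∈ T`, contradicting `s₀ = inf T`
    have hmem : s₀ - δ ∈ T := by
      refine ⟨by simp only [hδ]; linarith, fun s' hs' => ?_⟩
      rcases le_or_gt s' s₂ with h | h
      · exact hnew s' hs' h
      · exact hint₀ s' (lt_trans hs₀₂ h)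
    have := csInf_le hTbdd hmem
    linarith
  · have hs₀a : s₀ = a := le_antisymm (not_lt.1 hlt) has₀
    intro s hs
    rw [← hs₀a] at hs
    exact ⟨hint₀ s hs, heq₀ s hs⟩

end Landau

end Selberg

end Literature.Analysis.SpecialFunctions

end
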